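import Mathlib
import Summits.AnomalousDissipation.AnomalousDissipation.Theses.WazewskiBlock
import Literature.Analysis.FluidPDE.GalerkinFlow
import Literature.Dynamics.ConleyIndex.PolyfacialBlock
import HarnessLib

/-!
# Skeleton — line `Sketch` for the crux `WazewskiBlock.UniformGalerkinTrap`
# (stmt-AnomalousDissipation-10352), lead prover-line-stmt-AnomalousDissipation-10352-c1-0

The line is the ROUTE'S OWN declared mechanism — Conley–Ważewski for the three-face block — made into one
kernel-checked composition on the tree's Galerkin phase semiflow, with the idea card `quadric-exit-homology`
(ideator 2) entering through its transfer `Transversal ∧ NonRetract` (regular polyfacial sub-arm).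

Phase space at level `N`: `Phase N = ↥(galerkinSubspace (freqBall N))` (real divergence-free coefficient
vectors on the frequency ball), semiflow `phaseFlow ν f N = galerkinPhaseFlow ν (f̂|_{≤N})` (tree:
`galerkinPhaseFlow_semiflow`).  Block: `block N f E ε₀ G = {mean 0} ∩ {KEc ≤ E} ∩ {Wc ≥ ε₀} ∩ {Zc ≤ G}` with the
coefficient faces `KEc = ½∑‖c k‖²`, `Wc = ∑ Re⟪f̂ k, c k⟫`, `Zc = 4π²∑|k|²‖c k‖²` (= `kineticEnergy`, work
`∫⟪f,·⟫`, `eGradNormSq` of the synthesised field, tree dictionary).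

Composition (`UniformGalerkinTrap_of`, the only theorem concluding the crux unconditionally):

  stub_wazewskiBlock  — THE BET: ∃ trig-poly mean-zero f, E, ε₀, ν₀: ∀ 0<ν≤ν₀ ∃ G N₀ ∀ N≥N₀, the immediate exit
        │               set `block⁻` of the block under `phaseFlow ν f N` is CLOSED and `block` does not retract onto it
        │               (Conley's Ważewski hypothesis; Wazewski1947, Conley1978 Ch. II, HaleMagalhaesOliva2002 App. A p.307).
        ▼   engine (tree, proved): `IsSemiflow.exists_forall_mem_of_not_retract` ⟹ a phase point trapped in `block`
  stub_blockToWindow  — plumbing: trapped phase point ⟹ its synthesised field is a Galerkin mode whose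
        │               `Torus.galerkinFlow` orbit stays in the window {KE ≤ E, (f,·) ≥ ε₀, ‖∇·‖² ≤ G}
        ▼   `IsGalerkinMode.galerkinFlow_clauses` (tree) ⟹ the crux's clause block
  Theses.WazewskiBlock.UniformGalerkinTrap

Sub-arm (card `quadric-exit-homology`, C⁺ = (i) regular polyfacial + (ii) non-retract of the quadric exit set):
`bet_of_regular : RegularQuadricBet → WazewskiBlockBet` (proved; so `RegularQuadricBet` closes the crux through
`UniformGalerkinTrap_of`'s proof with the bet replaced), which consumes
  stub_meanZeroInvariant (mean mode conserved), stub_energy_hasDerivAt / stub_work_hasDerivAt /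
  stub_enstrophy_hasDerivAt (face derivatives along the phase flow: `Wc − νZc`, the work rate
  `∑ Re⟪f̂ k, V(c) k⟫ = Q_f + ν(U,Δf) + ‖P_N f‖²`, the enstrophy rate), and stub_exitClosed_of_transversal
  (exit set of a transversal polyfacial set relative to a closed invariant set — the tree's
  `IsRegularPolyfacial.immediateExitSet_eq` / `isClosed_immediateExitSet` with an invariant constraint set).
All stubs except the bet are def-free over tree vocabulary (landable verbatim under `Theorems/`).
-/

noncomputable section

-- `Summit.<Summit>.<Problem>` is the tree's mandated summit-side namespace (CONVENTIONS §2); deliberate duplicate.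
set_option linter.dupNamespace false

open MeasureTheory Set Filter Topology
open scoped ENNReal NNReal InnerProductSpace

namespace Summit.AnomalousDissipation.AnomalousDissipation.Cruxes.UniformGalerkinTrap.Lines.Sketch

open Literature.Analysis.FunctionSpaces Literature.Analysis.FunctionSpaces.Torus
open Literature.Analysis.FluidPDE Literature.Dynamics.ConleyIndex

local notation "𝕋³" => UnitAddTorus (Fin 3)
local notation "E³" => EuclideanSpace ℝ (Fin 3)
local notation "ℤ³" => Fin 3 → ℤ
local notation "ℂ³" => EuclideanSpace ℂ (Fin 3)

/-! ## §0 Vocabulary (transparent) -/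

/-- The crux's force clause: a mean-zero vector trigonometric polynomial of order `m`
(first conjunct is `IsGalerkinMode m f` by `Iff.rfl`). -/
def IsTrigPolyForce (m : ℕ) (f : 𝕋³ → E³) : Prop :=
  (Torus.IsSmooth f ∧ Torus.IsDivFree f ∧ ∀ k : ℤ³, ((m : ℕ) : ℝ) ^ 2 < Torus.freqNormSq k →
    UnitAddTorus.mFourierCoeff (EuclideanSpace.complexify ∘ f) k = 0) ∧ Torus.HasZeroMean f

theorem isTrigPolyForce_iff (m : ℕ) (f : 𝕋³ → E³) :
    IsTrigPolyForce m f ↔ IsGalerkinMode m f ∧ Torus.HasZeroMean f := Iff.rfl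

/-- The frequency ball of radius `N` in `ℤ³`. -/
abbrev ball (N : ℕ) : Finset ℤ³ := freqBall (d := Fin 3) N

/-- The Galerkin phase space of order `N`: real divergence-free coefficient vectors on the ball. -/
abbrev Phase (N : ℕ) : Type := ↥(galerkinSubspace (freqBall (d := Fin 3) N))

/-- The Galerkin phase semiflow of order `N` with viscosity `ν` and steady force `f`. -/
def phaseFlow (ν : ℝ) (f : 𝕋³ → E³) (N : ℕ) : ℝ → Phase N → Phase N :=
  galerkinPhaseFlow ν (fourierRestrict (freqBall (d := Fin 3) N) f)

/-- Coefficient kinetic energy `½ ∑ ‖c k‖²` (= `kineticEnergy` of the synthesised field). -/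
def KEc (N : ℕ) (x : Phase N) : ℝ := 2⁻¹ * ∑ k, ‖(x : ↥(ball N) → ℂ³) k‖ ^ 2

/-- Coefficient work `∑ Re⟪f̂ k, c k⟫` (= `∫⟪f, u⟫` of the synthesised field `u`). -/
def Wc (N : ℕ) (f : 𝕋³ → E³) (x : Phase N) : ℝ :=
  ∑ k, (inner ℂ (fourierRestrict (freqBall (d := Fin 3) N) f k) ((x : ↥(ball N) → ℂ³) k)).re

/-- Coefficient enstrophy `4π² ∑ |k|² ‖c k‖²` (= `eGradNormSq` of the synthesised field). -/
def Zc (N : ℕ) (x : Phase N) : ℝ :=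
  4 * Real.pi ^ 2 * ∑ k, Torus.freqNormSq ((k : ↥(ball N)) : ℤ³) * ‖(x : ↥(ball N) → ℂ³) k‖ ^ 2

/-- The work RATE along the Galerkin field: `∑ Re⟪f̂ k, V(c) k⟫` with `V = galerkinRHS`
(= `Q_f(U) + ν∫⟪U, Δf⟫ + ‖P_N f‖²` for the synthesised field). -/
def workRate (ν : ℝ) (N : ℕ) (f : 𝕋³ → E³) (x : Phase N) : ℝ :=
  ∑ k, (inner ℂ (fourierRestrict (freqBall (d := Fin 3) N) f k)
    (galerkinRHS (freqBall (d := Fin 3) N) ν (fourierRestrict (freqBall (d := Fin 3) N) f)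
      (x : ↥(ball N) → ℂ³) k)).re

/-- The enstrophy RATE along the Galerkin field: `4π² ∑ |k|² · 2 Re⟪c k, V(c) k⟫`. -/
def enstrophyRate (ν : ℝ) (N : ℕ) (f : 𝕋³ → E³) (x : Phase N) : ℝ :=
  4 * Real.pi ^ 2 * ∑ k, Torus.freqNormSq ((k : ↥(ball N)) : ℤ³) *
    (2 * (inner ℂ ((x : ↥(ball N) → ℂ³) k)
      (galerkinRHS (freqBall (d := Fin 3) N) ν (fourierRestrict (freqBall (d := Fin 3) N) f)
        (x : ↥(ball N) → ℂ³) k)).re)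

/-- `0 ∈ freqBall N`. -/
theorem zero_mem_ball (N : ℕ) : (0 : ℤ³) ∈ freqBall (d := Fin 3) N := by
  rw [mem_freqBall]
  simp only [Torus.freqNormSq, Pi.zero_apply, Int.cast_zero]
  norm_num

/-- The mean-zero phase vectors (the invariant subspace `{c 0 = 0}`, written without the membership proof). -/
def meanZero (N : ℕ) : Set (Phase N) :=
  {x | ∀ k : ↥(ball N), (k : ℤ³) = 0 → (x : ↥(ball N) → ℂ³) k = 0}

/-- **The block** of the line at level `N`: mean-zero phase vectors with `KEc ≤ E`, `Wc ≥ ε₀`, `Zc ≤ G`. -/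
def block (N : ℕ) (f : 𝕋³ → E³) (E ε₀ : ℝ) (G : ℝ≥0) : Set (Phase N) :=
  {x | x ∈ meanZero N ∧ KEc N x ≤ E ∧ ε₀ ≤ Wc N f x ∧ Zc N x ≤ (G : ℝ)}

/-- "`W` does not retract onto `W'`": no map continuous on `W`, into `W'`, fixing `W'` pointwise
(the binder shape of `IsSemiflow.exists_forall_mem_of_not_retract`). -/
def NonRetract {X : Type*} [TopologicalSpace X] (W W' : Set X) : Prop :=
  ¬ ∃ r : X → X, ContinuousOn r W ∧ MapsTo r W W' ∧ ∀ x ∈ W', r x = x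

/-- **THE BET of the line** (Conley's Ważewski hypothesis for the three-face block, at every large level, every
small viscosity): the immediate exit set of the block is closed and the block does not retract onto it. -/
def WazewskiBlockBet : Prop :=
  ∃ (m : ℕ) (f : 𝕋³ → E³), IsTrigPolyForce m f ∧ ∃ (E ε₀ ν₀ : ℝ), 0 < ε₀ ∧ 0 < ν₀ ∧
    ∀ ν : ℝ, 0 < ν → ν ≤ ν₀ → ∃ (G : ℝ≥0) (N₀ : ℕ), ∀ N : ℕ, N₀ ≤ N →
      IsClosed (immediateExitSet (phaseFlow ν f N) (block N f E ε₀ G)) ∧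
      NonRetract (block N f E ε₀ G) (immediateExitSet (phaseFlow ν f N) (block N f E ε₀ G))

/-- The three faces of the block as `faceSet` data on the phase space: `h 0 = E − KEc`, `h 1 = Wc − ε₀`,
`h 2 = G − Zc`. -/
def faces (N : ℕ) (f : 𝕋³ → E³) (E ε₀ : ℝ) (G : ℝ≥0) : Fin 3 → Phase N → ℝ
  | 0 => fun x => E - KEc N x
  | 1 => fun x => Wc N f x - ε₀
  | 2 => fun x => (G : ℝ) - Zc N x

/-- Their derivatives along the phase flow: `d 0 = −(Wc − ν Zc)`, `d 1 = workRate`, `d 2 = −enstrophyRate`. -/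
def faceDerivs (ν : ℝ) (N : ℕ) (f : 𝕋³ → E³) : Fin 3 → Phase N → ℝ
  | 0 => fun x => -(Wc N f x - ν * Zc N x)
  | 1 => fun x => workRate ν N f x
  | 2 => fun x => -enstrophyRate ν N f x

/-- The explicit (first-order) exit set of the regular sub-arm: block points with an active face of negative
derivative. -/
def regularExitSet (ν : ℝ) (N : ℕ) (f : 𝕋³ → E³) (E ε₀ : ℝ) (G : ℝ≥0) : Set (Phase N) :=
  {x | x ∈ faceSet (faces N f E ε₀ G) ∩ meanZero N ∧
    ∃ i, faces N f E ε₀ G i x = 0 ∧ faceDerivs ν N f i x < 0}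

/-- **The regular sub-arm's bet** (card `quadric-exit-homology`, transfer C⁺): (i) TRANSVERSALITY — on the block every
active face has non-zero derivative along the flow; (ii) the block does not retract onto the explicit exit set. -/
def RegularQuadricBet : Prop :=
  ∃ (m : ℕ) (f : 𝕋³ → E³), IsTrigPolyForce m f ∧ ∃ (E ε₀ ν₀ : ℝ), 0 < ε₀ ∧ 0 < ν₀ ∧
    ∀ ν : ℝ, 0 < ν → ν ≤ ν₀ → ∃ (G : ℝ≥0) (N₀ : ℕ), ∀ N : ℕ, N₀ ≤ N →
      (∀ x ∈ faceSet (faces N f E ε₀ G) ∩ meanZero N, ∀ i,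
        faces N f E ε₀ G i x = 0 → faceDerivs ν N f i x ≠ 0) ∧
      NonRetract (faceSet (faces N f E ε₀ G) ∩ meanZero N) (regularExitSet ν N f E ε₀ G)

/-! ## §1 Registered stubs

Stub signatures are written WITHOUT local notations and without named arguments (`(d := Fin 3)` is spelled as the
ascription `(freqBall N : Finset (Fin 3 → ℤ))`), so that the registered text re-elaborates verbatim in a worker's
`Theorems/` file that opens the same namespaces. -/

/-- **stub (THE BET).** -/
theorem stub_wazewskiBlock : WazewskiBlockBet := by
  sorry

/-- **stub (plumbing: the mean mode is conserved).** For `ν ≥ 0`, an integrable mean-zero force and a phase point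
with vanishing mean mode, the mean mode vanishes along the whole forward orbit of `galerkinPhaseFlow`
(the `k = 0` component of `galerkinRHS` vanishes: `f̂ 0 = 0`, the Stokes term has the factor `|0|² = 0`, and the
convection symbol at `0` is `∑ₘ (2πi c(−m)·m) c m = 0` by transversality). -/
theorem stub_meanZeroInvariant :
    ∀ (ν : ℝ) (N : ℕ) (f : UnitAddTorus (Fin 3) → EuclideanSpace ℝ (Fin 3))
      (x : ↥(galerkinSubspace (freqBall N : Finset (Fin 3 → ℤ)))) (t : ℝ),
      0 ≤ ν → Integrable f volume → Torus.HasZeroMean f →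
      (∀ k : ↥(freqBall N : Finset (Fin 3 → ℤ)), (k : Fin 3 → ℤ) = 0 →
        (x : ↥(freqBall N : Finset (Fin 3 → ℤ)) → EuclideanSpace ℂ (Fin 3)) k = 0) → 0 ≤ t →
      ∀ k : ↥(freqBall N : Finset (Fin 3 → ℤ)), (k : Fin 3 → ℤ) = 0 →
        (galerkinPhaseFlow ν (fourierRestrict (freqBall N : Finset (Fin 3 → ℤ)) f) t x :
          ↥(freqBall N : Finset (Fin 3 → ℤ)) → EuclideanSpace ℂ (Fin 3)) k = 0 := by
  sorry

/-- **stub (plumbing: trapped phase point ⟹ trapped `galerkinFlow` orbit in the window).** If the forward orbit of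
a phase point keeps `½∑‖c k‖² ≤ E`, `∑ Re⟪f̂ k, c k⟫ ≥ ε₀`, `4π²∑|k|²‖c k‖² ≤ G`, then its synthesised field is a
Galerkin mode of order `N` whose `Torus.galerkinFlow` orbit stays in `{kineticEnergy ≤ E, (f,·) ≥ ε₀, eGradNormSq ≤ G}`
(conjugacy `Torus.galerkinFlow_realTrigPoly` + dictionary `kineticEnergy_realTrigPoly_coeffExt`,
`integral_inner_realTrigPoly_right`, `eGradNormSq_realTrigPoly`). -/
theorem stub_blockToWindow :
    ∀ (ν : ℝ) (N : ℕ) (f : UnitAddTorus (Fin 3) → EuclideanSpace ℝ (Fin 3)) (E ε₀ : ℝ) (G : ℝ≥0)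
      (x : ↥(galerkinSubspace (freqBall N : Finset (Fin 3 → ℤ)))), 0 ≤ ν → MemLp f 2 volume →
      (∀ t : ℝ, 0 ≤ t →
        2⁻¹ * ∑ k, ‖(galerkinPhaseFlow ν (fourierRestrict (freqBall N : Finset (Fin 3 → ℤ)) f) t x :
            ↥(freqBall N : Finset (Fin 3 → ℤ)) → EuclideanSpace ℂ (Fin 3)) k‖ ^ 2 ≤ E ∧
        ε₀ ≤ ∑ k, (inner ℂ (fourierRestrict (freqBall N : Finset (Fin 3 → ℤ)) f k)
            ((galerkinPhaseFlow ν (fourierRestrict (freqBall N : Finset (Fin 3 → ℤ)) f) t x :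
              ↥(freqBall N : Finset (Fin 3 → ℤ)) → EuclideanSpace ℂ (Fin 3)) k)).re ∧
        4 * Real.pi ^ 2 * ∑ k, Torus.freqNormSq ((k : ↥(freqBall N : Finset (Fin 3 → ℤ))) : Fin 3 → ℤ) *
            ‖(galerkinPhaseFlow ν (fourierRestrict (freqBall N : Finset (Fin 3 → ℤ)) f) t x :
              ↥(freqBall N : Finset (Fin 3 → ℤ)) → EuclideanSpace ℂ (Fin 3)) k‖ ^ 2 ≤ (G : ℝ)) →
      IsGalerkinMode N (realTrigPoly (freqBall N : Finset (Fin 3 → ℤ))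
          (coeffExt (freqBall N : Finset (Fin 3 → ℤ))
            (x : ↥(freqBall N : Finset (Fin 3 → ℤ)) → EuclideanSpace ℂ (Fin 3)))) ∧
      ∀ t : ℝ, 0 ≤ t →
        kineticEnergy (Torus.galerkinFlow ν f N t (realTrigPoly (freqBall N : Finset (Fin 3 → ℤ))
          (coeffExt (freqBall N : Finset (Fin 3 → ℤ))
            (x : ↥(freqBall N : Finset (Fin 3 → ℤ)) → EuclideanSpace ℂ (Fin 3))))) ≤ E ∧
        ε₀ ≤ ∫ y, inner ℝ (f y) (Torus.galerkinFlow ν f N t (realTrigPoly (freqBall N : Finset (Fin 3 → ℤ))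
          (coeffExt (freqBall N : Finset (Fin 3 → ℤ))
            (x : ↥(freqBall N : Finset (Fin 3 → ℤ)) → EuclideanSpace ℂ (Fin 3)))) y) ∧
        eGradNormSq (Torus.galerkinFlow ν f N t (realTrigPoly (freqBall N : Finset (Fin 3 → ℤ))
          (coeffExt (freqBall N : Finset (Fin 3 → ℤ))
            (x : ↥(freqBall N : Finset (Fin 3 → ℤ)) → EuclideanSpace ℂ (Fin 3))))) ≤ (G : ℝ≥0∞) := by
  sorry

/-- **stub (plumbing: the energy face derivative).** Along the phase flow (`ν ≥ 0`, `f ∈ L²`), at every `t > 0`,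
`d/dt ½∑‖c k‖² = ∑ Re⟪f̂ k, c k⟫ − ν · 4π²∑|k|²‖c k‖²` (the exact energy identity in differential form,
`hasDerivWithinAt_energy` / `IsGalerkinODESolution.hasDerivAt`). -/
theorem stub_energy_hasDerivAt :
    ∀ (ν : ℝ) (N : ℕ) (f : UnitAddTorus (Fin 3) → EuclideanSpace ℝ (Fin 3))
      (x : ↥(galerkinSubspace (freqBall N : Finset (Fin 3 → ℤ)))) (t : ℝ),
      0 ≤ ν → MemLp f 2 volume → 0 < t →
      HasDerivAt
        (fun s => 2⁻¹ * ∑ k, ‖(galerkinPhaseFlow ν (fourierRestrict (freqBall N : Finset (Fin 3 → ℤ)) f) s x :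
            ↥(freqBall N : Finset (Fin 3 → ℤ)) → EuclideanSpace ℂ (Fin 3)) k‖ ^ 2)
        ((∑ k, (inner ℂ (fourierRestrict (freqBall N : Finset (Fin 3 → ℤ)) f k)
            ((galerkinPhaseFlow ν (fourierRestrict (freqBall N : Finset (Fin 3 → ℤ)) f) t x :
              ↥(freqBall N : Finset (Fin 3 → ℤ)) → EuclideanSpace ℂ (Fin 3)) k)).re) -
          ν * (4 * Real.pi ^ 2 * ∑ k, Torus.freqNormSq ((k : ↥(freqBall N : Finset (Fin 3 → ℤ))) : Fin 3 → ℤ) *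
            ‖(galerkinPhaseFlow ν (fourierRestrict (freqBall N : Finset (Fin 3 → ℤ)) f) t x :
              ↥(freqBall N : Finset (Fin 3 → ℤ)) → EuclideanSpace ℂ (Fin 3)) k‖ ^ 2)) t := by
  sorry

/-- **stub (plumbing: the work face derivative).** Along the phase flow (`ν ≥ 0`, `f ∈ L²`), at every `t > 0`,
`d/dt ∑ Re⟪f̂ k, c k⟫ = ∑ Re⟪f̂ k, V(c) k⟫`, `V = galerkinRHS` (chain rule through the continuous linear work
functional; `IsGalerkinODESolution.hasDerivAt`). -/
theorem stub_work_hasDerivAt :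
    ∀ (ν : ℝ) (N : ℕ) (f : UnitAddTorus (Fin 3) → EuclideanSpace ℝ (Fin 3))
      (x : ↥(galerkinSubspace (freqBall N : Finset (Fin 3 → ℤ)))) (t : ℝ),
      0 ≤ ν → MemLp f 2 volume → 0 < t →
      HasDerivAt
        (fun s => ∑ k, (inner ℂ (fourierRestrict (freqBall N : Finset (Fin 3 → ℤ)) f k)
            ((galerkinPhaseFlow ν (fourierRestrict (freqBall N : Finset (Fin 3 → ℤ)) f) s x :
              ↥(freqBall N : Finset (Fin 3 → ℤ)) → EuclideanSpace ℂ (Fin 3)) k)).re)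
        (∑ k, (inner ℂ (fourierRestrict (freqBall N : Finset (Fin 3 → ℤ)) f k)
            (galerkinRHS (freqBall N : Finset (Fin 3 → ℤ)) ν (fourierRestrict (freqBall N : Finset (Fin 3 → ℤ)) f)
              (galerkinPhaseFlow ν (fourierRestrict (freqBall N : Finset (Fin 3 → ℤ)) f) t x :
                ↥(freqBall N : Finset (Fin 3 → ℤ)) → EuclideanSpace ℂ (Fin 3)) k)).re) t := by
  sorry

/-- **stub (plumbing: the enstrophy face derivative).** Along the phase flow (`ν ≥ 0`, `f ∈ L²`), at every `t > 0`,
`d/dt 4π²∑|k|²‖c k‖² = 4π² ∑ |k|² · 2 Re⟪c k, V(c) k⟫` (chain rule; `IsGalerkinODESolution.hasDerivAt`). -/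
theorem stub_enstrophy_hasDerivAt :
    ∀ (ν : ℝ) (N : ℕ) (f : UnitAddTorus (Fin 3) → EuclideanSpace ℝ (Fin 3))
      (x : ↥(galerkinSubspace (freqBall N : Finset (Fin 3 → ℤ)))) (t : ℝ),
      0 ≤ ν → MemLp f 2 volume → 0 < t →
      HasDerivAt
        (fun s => 4 * Real.pi ^ 2 * ∑ k, Torus.freqNormSq ((k : ↥(freqBall N : Finset (Fin 3 → ℤ))) : Fin 3 → ℤ) *
            ‖(galerkinPhaseFlow ν (fourierRestrict (freqBall N : Finset (Fin 3 → ℤ)) f) s x :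
              ↥(freqBall N : Finset (Fin 3 → ℤ)) → EuclideanSpace ℂ (Fin 3)) k‖ ^ 2)
        (4 * Real.pi ^ 2 * ∑ k, Torus.freqNormSq ((k : ↥(freqBall N : Finset (Fin 3 → ℤ))) : Fin 3 → ℤ) *
            (2 * (inner ℂ ((galerkinPhaseFlow ν (fourierRestrict (freqBall N : Finset (Fin 3 → ℤ)) f) t x :
                ↥(freqBall N : Finset (Fin 3 → ℤ)) → EuclideanSpace ℂ (Fin 3)) k)
              (galerkinRHS (freqBall N : Finset (Fin 3 → ℤ)) ν (fourierRestrict (freqBall N : Finset (Fin 3 → ℤ)) f)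
                (galerkinPhaseFlow ν (fourierRestrict (freqBall N : Finset (Fin 3 → ℤ)) f) t x :
                  ↥(freqBall N : Finset (Fin 3 → ℤ)) → EuclideanSpace ℂ (Fin 3)) k)).re)) t := by
  sorry

/-- **stub (plumbing, pure topology: exit set of a transversal polyfacial set relative to a closed invariant set).**
For a continuous semiflow `φ`, finitely many continuous faces `h i` with continuous flow-derivatives `d i`, and a
closed forward-invariant set `M`: if every active face is transversal on `faceSet h ∩ M`, then the immediate exit set
of `faceSet h ∩ M` is `{x ∈ faceSet h ∩ M | ∃ i, h i x = 0 ∧ d i x < 0}` and it is closed (the tree's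
`IsRegularPolyfacial.immediateExitSet_eq` / `isClosed_immediateExitSet` are the case `M = univ`). -/
theorem stub_exitClosed_of_transversal :
    ∀ {X : Type} [TopologicalSpace X] {ι : Type} [Finite ι] (φ : ℝ → X → X) (h d : ι → X → ℝ)
      (M : Set X), IsSemiflow φ → (∀ i, Continuous (h i)) → (∀ i, Continuous (d i)) →
      (∀ i x t, 0 < t → HasDerivAt (fun s => h i (φ s x)) (d i (φ t x)) t) →
      IsClosed M → (∀ x ∈ M, ∀ t : ℝ, 0 ≤ t → φ t x ∈ M) →
      (∀ x ∈ faceSet h ∩ M, ∀ i, h i x = 0 → d i x ≠ 0) →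
      immediateExitSet φ (faceSet h ∩ M) =
          {x | x ∈ faceSet h ∩ M ∧ ∃ i, h i x = 0 ∧ d i x < 0} ∧
        IsClosed (immediateExitSet φ (faceSet h ∩ M)) := by
  sorry

/-! ## §2 Proved plumbing -/

/-- The phase flow is a continuous semiflow (`ν ≥ 0`, `f` integrable). -/
theorem isSemiflow_phaseFlow {ν : ℝ} (hν : 0 ≤ ν) {f : 𝕋³ → E³} (hf : Integrable f volume) (N : ℕ) :
    IsSemiflow (phaseFlow ν f N) := by
  obtain ⟨h1, h2, h3⟩ := galerkinPhaseFlow_semiflow (S := freqBall (d := Fin 3) N) hν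
    neg_mem_freqBall_of_mem (isRealCoeff_mFourierCoeff (S := freqBall (d := Fin 3) N) hf) (ν := ν)
  exact ⟨h1, h2, h3⟩

/-- Coordinates are continuous on the phase space. -/
theorem continuous_coord (N : ℕ) (k : ↥(ball N)) : Continuous fun x : Phase N => (x : ↥(ball N) → ℂ³) k :=
  (continuous_apply k).comp continuous_subtype_val

/-- `KEc` is continuous. -/
theorem continuous_KEc (N : ℕ) : Continuous (KEc N) :=
  continuous_const.mul (continuous_finsetSum _ fun k _ => ((continuous_coord N k).norm).pow 2)

/-- `Wc` is continuous. -/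
theorem continuous_Wc (N : ℕ) (f : 𝕋³ → E³) : Continuous (Wc N f) :=
  continuous_finsetSum _ fun k _ => Complex.continuous_re.comp (continuous_const.inner (continuous_coord N k))

/-- `Zc` is continuous. -/
theorem continuous_Zc (N : ℕ) : Continuous (Zc N) :=
  continuous_const.mul (continuous_finsetSum _ fun k _ =>
    continuous_const.mul (((continuous_coord N k).norm).pow 2))

/-- The mean-zero set is closed. -/
theorem isClosed_meanZero (N : ℕ) : IsClosed (meanZero N) := by
  have : meanZero N = ⋂ k : ↥(ball N), {x : Phase N | (k : ℤ³) = 0 → (x : ↥(ball N) → ℂ³) k = 0} := by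
    ext x; simp [meanZero]
  rw [this]
  refine isClosed_iInter fun k => ?_
  by_cases hk : (k : ℤ³) = 0
  · simpa [hk] using isClosed_eq (continuous_coord N k) continuous_const
  · simp [hk]

/-- The block is closed. -/
theorem isClosed_block (N : ℕ) (f : 𝕋³ → E³) (E ε₀ : ℝ) (G : ℝ≥0) : IsClosed (block N f E ε₀ G) := by
  have : block N f E ε₀ G = meanZero N ∩ (KEc N ⁻¹' Iic E ∩ (Wc N f ⁻¹' Ici ε₀ ∩ Zc N ⁻¹' Iic (G : ℝ))) := by
    ext x; simp only [block, Set.mem_setOf_eq, Set.mem_inter_iff, Set.mem_preimage, Set.mem_Iic, Set.mem_Ici]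
  rw [this]
  exact (isClosed_meanZero N).inter ((isClosed_Iic.preimage (continuous_KEc N)).inter
    ((isClosed_Ici.preimage (continuous_Wc N f)).inter (isClosed_Iic.preimage (continuous_Zc N))))

/-- The block is the polyfacial set of its three faces cut by the mean-zero subspace. -/
theorem block_eq_faceSet_inter (N : ℕ) (f : 𝕋³ → E³) (E ε₀ : ℝ) (G : ℝ≥0) :
    block N f E ε₀ G = faceSet (faces N f E ε₀ G) ∩ meanZero N := by
  ext x
  simp only [block, Set.mem_setOf_eq, Set.mem_inter_iff, mem_faceSet_iff, Fin.forall_fin_succ,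
    Fin.succ_zero_eq_one, Fin.succ_one_eq_two, IsEmpty.forall_iff, and_true, faces, sub_nonneg]
  tauto

/-- The mean-zero set is forward invariant (from `stub_meanZeroInvariant`). -/
theorem meanZero_invariant {ν : ℝ} (hν : 0 ≤ ν) {m : ℕ} {f : 𝕋³ → E³} (hf : IsTrigPolyForce m f) (N : ℕ) :
    ∀ x ∈ meanZero N, ∀ t : ℝ, 0 ≤ t → phaseFlow ν f N t x ∈ meanZero N :=
  fun x hx t ht => stub_meanZeroInvariant ν N f x t hν hf.1.1.continuous.integrable_unitAddTorus hf.2 hx ht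

/-- The faces are continuous. -/
theorem continuous_faces (N : ℕ) (f : 𝕋³ → E³) (E ε₀ : ℝ) (G : ℝ≥0) :
    ∀ i, Continuous (faces N f E ε₀ G i) := by
  intro i
  fin_cases i
  · exact continuous_const.sub (continuous_KEc N)
  · exact (continuous_Wc N f).sub continuous_const
  · exact continuous_const.sub (continuous_Zc N)

/-- The Galerkin field is continuous on the phase space (coordinatewise polynomial). -/
theorem continuous_galerkinRHS_coord (ν : ℝ) (N : ℕ) (f : 𝕋³ → E³) (k : ↥(ball N)) :
    Continuous fun x : Phase N =>
      galerkinRHS (freqBall (d := Fin 3) N) ν (fourierRestrict (freqBall (d := Fin 3) N) f)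
        (x : ↥(ball N) → ℂ³) k := by
  have hC : ∀ l : ℤ³, Continuous fun x : Phase N => coeffExt (freqBall (d := Fin 3) N) (x : ↥(ball N) → ℂ³) l := by
    intro l
    unfold coeffExt
    split_ifs with hl
    · exact continuous_coord N ⟨l, hl⟩
    · exact continuous_const
  simpa only [galerkinRHS_apply] using
    Literature.Analysis.FluidPDE.Torus.continuous_galerkinField ν (S := freqBall (d := Fin 3) N)
      (G := fun (_ : Phase N) => coeffExt (freqBall (d := Fin 3) N) (fourierRestrict (freqBall (d := Fin 3) N) f))
      (fun l => continuous_const) hC (k : ℤ³)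

/-- The face derivatives are continuous. -/
theorem continuous_faceDerivs (ν : ℝ) (N : ℕ) (f : 𝕋³ → E³) : ∀ i, Continuous (faceDerivs ν N f i) := by
  have hW : Continuous (workRate ν N f) :=
    continuous_finsetSum _ fun k _ =>
      Complex.continuous_re.comp (continuous_const.inner (continuous_galerkinRHS_coord ν N f k))
  have hZ : Continuous (enstrophyRate ν N f) :=
    continuous_const.mul (continuous_finsetSum _ fun k _ => continuous_const.mul
      (continuous_const.mul (Complex.continuous_re.comp
        ((continuous_coord N k).inner (continuous_galerkinRHS_coord ν N f k)))))
  intro i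
  fin_cases i
  · exact ((continuous_Wc N f).sub (continuous_const.mul (continuous_Zc N))).neg
  · exact hW
  · exact hZ.neg

/-- The face derivatives ARE the derivatives of the faces along the phase flow (from the three derivative stubs). -/
theorem faces_hasDerivAt {ν : ℝ} (hν : 0 ≤ ν) (N : ℕ) {f : 𝕋³ → E³} (hf : MemLp f 2 volume) (E ε₀ : ℝ)
    (G : ℝ≥0) : ∀ i (x : Phase N) (t : ℝ), 0 < t →
      HasDerivAt (fun s => faces N f E ε₀ G i (phaseFlow ν f N s x)) (faceDerivs ν N f i (phaseFlow ν f N t x)) t := by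
  intro i x t ht
  fin_cases i
  · have h := (stub_energy_hasDerivAt ν N f x t hν hf ht).const_sub E
    exact h
  · have h := (stub_work_hasDerivAt ν N f x t hν hf ht).sub_const ε₀
    exact h
  · have h := (stub_enstrophy_hasDerivAt ν N f x t hν hf ht).const_sub (G : ℝ)
    exact h

/-- **The regular sub-arm feeds the bet.**  Transversality on the block (plus the derivative and invariance stubs)
makes the block's immediate exit set the explicit first-order set and closed (`stub_exitClosed_of_transversal`);
non-retraction onto that set is then non-retraction onto the exit set. -/
theorem bet_of_regular : RegularQuadricBet → WazewskiBlockBet := by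
  rintro ⟨m, f, hf, E, ε₀, ν₀, hε₀, hν₀, h⟩
  refine ⟨m, f, hf, E, ε₀, ν₀, hε₀, hν₀, fun ν hν hνle => ?_⟩
  obtain ⟨G, N₀, hN⟩ := h ν hν hνle
  refine ⟨G, N₀, fun N hN₀ => ?_⟩
  obtain ⟨htrans, hnr⟩ := hN N hN₀
  have hf2 : MemLp f 2 volume := hf.1.1.memLp 2
  obtain ⟨heq, hclosed⟩ := stub_exitClosed_of_transversal (phaseFlow ν f N) (faces N f E ε₀ G)
    (faceDerivs ν N f) (meanZero N) (isSemiflow_phaseFlow hν.le hf.1.1.continuous.integrable_unitAddTorus N)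
    (continuous_faces N f E ε₀ G) (continuous_faceDerivs ν N f) (faces_hasDerivAt hν.le N hf2 E ε₀ G)
    (isClosed_meanZero N) (meanZero_invariant hν.le hf N) htrans
  rw [block_eq_faceSet_inter]
  refine ⟨hclosed, ?_⟩
  rw [heq]
  exact hnr

/-! ## §3 Composition: the registered stubs prove the crux BY NAME -/

/-- **Composition of the line `Sketch`** — the FIRST theorem of the file concluding the crux, unconditionally modulo the
registered stubs: the bet (`stub_wazewskiBlock`) gives, at every `(ν, N)`, a closed exit set onto which the block does
not retract; Ważewski's retract principle (tree engine `IsSemiflow.exists_forall_mem_of_not_retract`) gives a phase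
point whose forward orbit stays in the block; `stub_blockToWindow` turns it into a Galerkin mode whose
`Torus.galerkinFlow` orbit stays in the window; `IsGalerkinMode.galerkinFlow_clauses` supplies the clause block. -/
theorem UniformGalerkinTrap_of : Theses.WazewskiBlock.UniformGalerkinTrap := by
  obtain ⟨m, f, hf, E, ε₀, ν₀, hε₀, hν₀, h⟩ := stub_wazewskiBlock
  refine ⟨m, f, hf.1, hf.2, E, ε₀, ν₀, hε₀, hν₀, fun ν hν hνle => ?_⟩
  obtain ⟨G, N₀, hN⟩ := h ν hν hνle
  refine ⟨G, N₀, fun N hN₀ => ?_⟩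
  obtain ⟨hclosed, hnr⟩ := hN N hN₀
  have hfi : Integrable f volume := hf.1.1.continuous.integrable_unitAddTorus
  have hf2 : MemLp f 2 volume := hf.1.1.memLp 2
  have hsf : IsSemiflow (phaseFlow ν f N) := isSemiflow_phaseFlow hν.le hfi N
  obtain ⟨x, hx, htrap⟩ := hsf.exists_forall_mem_of_not_retract (isClosed_block N f E ε₀ G) hclosed hnr
  obtain ⟨hmode, hwin⟩ := stub_blockToWindow ν N f E ε₀ G x hν.le hf2 (fun t ht => (htrap t ht).2)
  obtain ⟨-, hcont, hslice, htest, henergy⟩ := hmode.galerkinFlow_clauses (ν := ν) hν.le hf2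
  exact ⟨fun t => Torus.galerkinFlow ν f N t (realTrigPoly (freqBall (d := Fin 3) N)
      (coeffExt (freqBall (d := Fin 3) N) (x : ↥(freqBall (d := Fin 3) N) → ℂ³))),
    ⟨hcont, fun t ht => hslice t ht, fun b hb s t hs hst => htest b hb s t hs hst, henergy⟩, hwin⟩

end Summit.AnomalousDissipation.AnomalousDissipation.Cruxes.UniformGalerkinTrap.Lines.Sketch

end
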